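/-
Copyright (c) 2026 the pub-hodgecm-mathlib formalisation cell (harness21).  Prover seat hodgecm-mathlib-K2E4-p11 (g9): Track B «K2-LIT»,
hLiu418 = stmt-HodgeConjecture-24832, socket #41 KIND W, organ «Φ6b-ind» FILE 1 (LEAD F0P6-plan (g14) BATCH #178 (1), KW desk F0P2-p08 (g3)):
THE ξ–η IDENTITY ON `Herm₂(ℂ)` FOR A HERMITIAN `h` OF ANY SIGNATURE — `ξ(g, h; α, β) = 4π⁴ · e^{iπ(β−α)} · Γ₂(α)⁻¹ Γ₂(β)⁻¹ · η(2g, πh; α, β)`.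
THEOREMS ONLY (no `def`, no `instance`, no `notation`, no named-fact hypothesis, no `sorry`).
-/
import Summits.HodgeConjecture.HodgeConjecture.Theorems.K2LiuHermTwoXiEtaIdentity      -- ★ (K2E5-p16) the `h > 0` identity and its tools (`phase_combine`, `trace_combine`, `integrable_double`)
import HarnessLib

/-!
# Crux `HLiu418`, ROAD Φ ∕ KIND W organ «Φ6b-ind», FILE 1: the ξ–η IDENTITY on `Herm₂(ℂ)` for `h` of ANY signature
# `ξ(g, h; α, β) = 4π⁴ · e^{iπ(β−α)} · Γ₂(α)⁻¹ Γ₂(β)⁻¹ · η(2g, πh; α, β)`   (`g > 0`, `h = h*` arbitrary, `re α > 3`, `re β > 1`)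

Cell `hodgecm-mathlib`, crux item hLiu418 = `stmt-HodgeConjecture-24832` (helper lane `--supports … --as helper`, count-neutral), route of record
`HCCMUnconditional`; squad K2 ∕ K2Liu, road `K2_Liu`, socket #41, KIND W.  The KIND-W archimedean letter (★ p863137 `harch_of_blockLetters`' block
letter `hBL`, ★ p863152's `hex`, LH4-p10's per-place `hW w`) is read at every NON-SINGULAR framed index, i.e. at Hermitian `2 × 2` indices of
signature (2,0), (0,2) AND (1,1); the ★ n = 2 Shimura sheet (`K2LiuHermTwo*`, K2E5-p16 et al.) treats `h > 0` (and `h ≥ 0`, `h = 0`, rank one)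
only.  THIS FILE is the first brick of the indefinite row: the ξ–η identity [Shimura1982, (1.29)] with NO sign condition on `h`.

WHY IT HOLDS VERBATIM.  ★ `K2LiuHermTwoXiEtaIdentity.xiTwo_eq_etaTwo` uses `h > 0` at exactly two places: (a) to evaluate the Fourier inversion of
the Gamma kernel `φ_s = 1_{x>0} e^{−τ(xg)} det(x)^{s−2}` (★ `integral_cexp_trace_mul_det_cpow`) at the point `w = u + 2πh`, assumed in the OPEN cone,
and (b) to rewrite the domain of `η` as `{x − πh > 0}`.  For (a): `φ_s` is continuous at EVERY point of the chart once `re s > 2` — on the open cone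
(★ `continuousAt_gammaKernel_of_posDef`), off the closed cone (★ `continuousAt_gammaKernel_of_not_mem_closure`), and at the frontier, where `det = 0`
(§1 `det_eq_zero_of_mem_closure_of_not_posDef`) and `|φ_s(x)| ≤ ‖e^{−τ(xg)}‖ · |det x|^{re s − 2} → 0` (§1 `continuousAt_gammaKernel`) — so Mathlib's
pointwise inversion `Integrable.fourier_fourierInv_eq` gives §2 **`integral_cexp_trace_mul_det_cpow_eq_indicator`**:
`∫ e^{−iτ(wx)} Γ₂(s) det(g − ix)^{−s} dx = 4π⁴ · φ_s(w)` for EVERY `w` (the transform of `det(g − ix)^{−s}` is supported on the closed cone).  For (b):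
the `u`-integrand becomes `φ_β(u) · φ_α(u + 2πh)`, supported on `{u > 0} ∩ {u + 2πh > 0}`, which the translation `x = u + πh` carries onto
`{x − πh > 0} ∩ {x + πh > 0} = etaTwoSet (πh)` (★ `mem_etaTwoSet_iff`) — §4 `integral_kernel_shift_eq_etaTwo_of_isHermitian`.  §3 is the inner integral
with the indicator kept, §5 the HEAD **`xiTwo_eq_etaTwo_of_isHermitian`** — ★ `xiTwo_eq_etaTwo`'s conclusion BYTE-VERBATIM with `hh : h.PosDef` weakened
to `hh : h.IsHermitian` (★'s `h > 0` ∕ `h ≥ 0` versions are the special cases `hh.1` ∕ `hh.1`; not restated).  On the indefinite row `η(2g, πh; α, β)` converges for `re α > 1 ∧ re β > 1`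
(both determinant factors degenerate on the domain), so this identity is the continuation mechanism of `ξ` down to that quadrant; the continuation
across `re α = 1` (Shimura §4, Thm. 4.2) is the organ's open core (FILE 3+).
[Shimura1982, §1 (1.25)–(1.29), §3 (3.1)–(3.3), §4 Thm. 4.2] [Shimura1997, §16.4, §18.4] [SteinWeiss1971, Ch. I §2 (Fourier inversion at a point of continuity)].
HONEST LABEL.  Count-neutral helper of the K2_Liu road; it pays no socket by itself: `HC_CM` is proved only modulo the 7 printed citations
(2 remaining named inputs: hLiu418 = `stmt-HodgeConjecture-24832`, h413 = `stmt-HodgeConjecture-24833`) until rung 0 closes.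

## References
* [Shimura1982] G. Shimura, *Confluent hypergeometric functions on tube domains*, Math. Ann. 260 (1982) 269–302: §1 (1.25)–(1.29), §3, §4 Thm. 4.2.
* [Shimura1997] G. Shimura, *Euler Products and Eisenstein Series*, CBMS 93 (1997): §16.4, §18.4.
* [SteinWeiss1971] E. M. Stein, G. Weiss, *Introduction to Fourier Analysis on Euclidean Spaces* (1971): Ch. I §2.
-/

set_option autoImplicit false
-- the mandated namespace repeats the single-problem summit's segment (`HodgeConjecture.HodgeConjecture`)
set_option linter.dupNamespace false

noncomputable section

open Complex MeasureTheory Set WithLp Filter Topology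
open scoped ComplexOrder ComplexConjugate RealInnerProductSpace FourierTransform

namespace Summit.HodgeConjecture.HodgeConjecture.Cruxes.HLiu418.K2LiuHermTwoXiEtaIdentityIndefinite

open Summit.HodgeConjecture.HodgeConjecture.Cruxes.HLiu418.K2LiuHermTwoGammaDefs
open Summit.HodgeConjecture.HodgeConjecture.Cruxes.HLiu418.K2LiuHermTwoGammaSiegelGindikin
open Summit.HodgeConjecture.HodgeConjecture.Cruxes.HLiu418.K2LiuHermTwoGammaKernelFourier
open Summit.HodgeConjecture.HodgeConjecture.Cruxes.HLiu418.K2LiuHermTwoGammaKernelInversion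
open Summit.HodgeConjecture.HodgeConjecture.Cruxes.HLiu418.K2LiuHermTwoChartLp
open Summit.HodgeConjecture.HodgeConjecture.Cruxes.HLiu418.K2LiuHermTwoDetPowerIntegrable
open Summit.HodgeConjecture.HodgeConjecture.Cruxes.HLiu418.K2LiuHermTwoConfluentXiDefs
open Summit.HodgeConjecture.HodgeConjecture.Cruxes.HLiu418.K2LiuHermTwoConfluentXiConvergence
open Summit.HodgeConjecture.HodgeConjecture.Cruxes.HLiu418.K2LiuHermTwoEtaDefs
open Summit.HodgeConjecture.HodgeConjecture.Cruxes.HLiu418.K2LiuHermTwoXiEtaIdentity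

/-! ## §1 The Gamma kernel is continuous at every point of the chart (`re s > 2`) -/

/-- A frontier point of the open cone `Herm₂(ℂ)⁺` (in the closure, not in the cone) has `det = 0`: the closure of `{0 < a, |z|² < ab}` lies in
`{0 ≤ a, |z|² ≤ ab}`, and `|z|² < ab` with `0 ≤ a` forces `0 < a`. [folklore] -/
theorem det_eq_zero_of_mem_closure_of_not_posDef {c : ℝ × ℂ × ℝ} (hc : c ∈ closure {c : ℝ × ℂ × ℝ | (hermTwo c).PosDef})
    (hc' : ¬ (hermTwo c).PosDef) : c.1 * c.2.2 - normSq c.2.1 = 0 := by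
  rw [setOf_posDef_hermTwo] at hc
  rw [posDef_hermTwo_iff] at hc'
  have hsub : closure {c : ℝ × ℂ × ℝ | 0 < c.1 ∧ normSq c.2.1 < c.1 * c.2.2} ⊆ {c | 0 ≤ c.1} ∩ {c | normSq c.2.1 ≤ c.1 * c.2.2} := by
    rw [Set.setOf_and]
    refine (closure_inter_subset_inter_closure _ _).trans (Set.inter_subset_inter ?_ ?_)
    · exact closure_lt_subset_le continuous_const continuous_fst
    · exact closure_lt_subset_le (Complex.continuous_normSq.comp continuous_snd.fst) (continuous_fst.mul continuous_snd.snd)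
  obtain ⟨h0, hle⟩ := hsub hc
  simp only [Set.mem_setOf_eq] at h0 hle
  by_contra hne
  have hlt : normSq c.2.1 < c.1 * c.2.2 := lt_of_le_of_ne hle fun h => hne (by linarith)
  have hpos : 0 < c.1 := by
    rcases h0.lt_or_eq with h | h
    · exact h
    · exfalso
      have : normSq c.2.1 < 0 := by rw [← h, zero_mul] at hlt; exact hlt
      exact absurd this (not_lt.mpr (normSq_nonneg _))
  exact hc' ⟨hpos, hlt⟩

/-- **THE GAMMA KERNEL `φ_s = 1_{x>0} · e^{−τ(xg)} · det(x)^{s−2}` IS CONTINUOUS AT EVERY POINT** when `re s > 2`: on the open cone ★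
`continuousAt_gammaKernel_of_posDef`, off the closed cone ★ `continuousAt_gammaKernel_of_not_mem_closure`, and at a frontier point `c` (`det c = 0`)
it tends to `0 = φ_s(c)` by the majorant `‖φ_s(x)‖ ≤ ‖e^{−τ(xg)}‖ · |det x|^{re s − 2}`. [cite: SteinWeiss1971, Ch. I §2] -/
theorem continuousAt_gammaKernel (g : Matrix (Fin 2) (Fin 2) ℂ) {s : ℂ} (hs : 2 < s.re) (c : ℝ × ℂ × ℝ) :
    ContinuousAt (fun c : ℝ × ℂ × ℝ =>
      {c : ℝ × ℂ × ℝ | (hermTwo c).PosDef}.indicator (fun c => cexp (-(hermTwo c * g).trace) * (hermTwo c).det ^ (s - 2)) c) c := by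
  by_cases hc : (hermTwo c).PosDef
  · exact continuousAt_gammaKernel_of_posDef g s hc
  by_cases hcl : c ∈ closure {c : ℝ × ℂ × ℝ | (hermTwo c).PosDef}
  swap
  · exact continuousAt_gammaKernel_of_not_mem_closure g s hcl
  -- a frontier point: `det = 0` and the kernel tends to `0`
  have hD : c.1 * c.2.2 - normSq c.2.1 = 0 := det_eq_zero_of_mem_closure_of_not_posDef hcl hc
  have hσ : 0 < s.re - 2 := by linarith
  have hE : Continuous fun c : ℝ × ℂ × ℝ => cexp (-(hermTwo c * g).trace) := by
    have hf : (fun c : ℝ × ℂ × ℝ => (hermTwo c * g).trace) =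
        fun c => (c.1 : ℂ) * g 0 0 + c.2.1 * g 1 0 + (conj c.2.1 * g 0 1 + (c.2.2 : ℂ) * g 1 1) := by
      funext c
      rw [Matrix.trace_fin_two, Matrix.mul_apply, Matrix.mul_apply, Fin.sum_univ_two, Fin.sum_univ_two]
      simp [hermTwo]
    have hcont : Continuous fun c : ℝ × ℂ × ℝ => (hermTwo c * g).trace := by rw [hf]; fun_prop
    exact Complex.continuous_exp.comp hcont.neg
  have hDc : Continuous fun c : ℝ × ℂ × ℝ => c.1 * c.2.2 - normSq c.2.1 := by fun_prop
  -- the majorant tends to `0` at `c`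
  have hmaj : Tendsto (fun x : ℝ × ℂ × ℝ => ‖cexp (-(hermTwo x * g).trace)‖ * |x.1 * x.2.2 - normSq x.2.1| ^ (s.re - 2)) (𝓝 c) (𝓝 0) := by
    have h1 : ContinuousAt (fun x : ℝ × ℂ × ℝ => ‖cexp (-(hermTwo x * g).trace)‖ * |x.1 * x.2.2 - normSq x.2.1| ^ (s.re - 2)) c :=
      hE.norm.continuousAt.mul (((continuous_abs.comp hDc).continuousAt).rpow_const (Or.inr hσ.le))
    have h0 : ‖cexp (-(hermTwo c * g).trace)‖ * |c.1 * c.2.2 - normSq c.2.1| ^ (s.re - 2) = 0 := by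
      rw [hD, abs_zero, Real.zero_rpow hσ.ne', mul_zero]
    have h2 := h1.tendsto
    rw [h0] at h2
    exact h2
  -- squeeze
  have hK0 : {c : ℝ × ℂ × ℝ | (hermTwo c).PosDef}.indicator (fun c => cexp (-(hermTwo c * g).trace) * (hermTwo c).det ^ (s - 2)) c = 0 :=
    gammaKernel_eq_zero_of_not_posDef g s hc
  rw [ContinuousAt, hK0]
  refine squeeze_zero_norm (fun x => ?_) hmaj
  by_cases hx : (hermTwo x).PosDef
  · rw [gammaKernel_eq_of_posDef g s hx, norm_mul, det_hermTwo]
    have hpos : 0 < x.1 * x.2.2 - normSq x.2.1 := by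
      have h := (posDef_hermTwo_iff x).mp hx
      linarith [h.2]
    rw [Complex.norm_cpow_eq_rpow_re_of_pos hpos, Complex.sub_re, Complex.re_ofNat, abs_of_pos hpos]
  · rw [gammaKernel_eq_zero_of_not_posDef g s hx, norm_zero]
    positivity

/-! ## §2 Fourier inversion of the Gamma kernel at EVERY point -/

/-- **FOURIER INVERSION OF THE GAMMA KERNEL AT EVERY POINT**: for `g > 0`, `re s > 3` and ANY `w` in the chart,
`∫ e^{−iτ(w x)} · Γ₂(s) det(g − ix)^{−s} dx = 4π⁴ · 1_{w>0} · e^{−τ(w g)} det(w)^{s−2}` — ★ `integral_cexp_trace_mul_det_cpow` off the hypothesis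
`w > 0` (the transform of `det(g − ix)^{−s}` VANISHES off the closed cone), by Mathlib's pointwise inversion at the continuity point `w` (§1).
[cite: Shimura1982, §1 (1.25)–(1.29)] [cite: SteinWeiss1971, Ch. I §2] -/
theorem integral_cexp_trace_mul_det_cpow_eq_indicator {g : Matrix (Fin 2) (Fin 2) ℂ} (hg : g.PosDef) {s : ℂ} (hs : 3 < s.re) (w : ℝ × ℂ × ℝ) :
    ∫ c : ℝ × ℂ × ℝ, cexp (-(I * (hermTwo w * hermTwo c).trace)) * (hermTwoGamma s * (g - I • hermTwo c).det ^ (-s)) =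
      ((4 * Real.pi ^ 4 : ℝ) : ℂ) *
        {x : ℝ × ℂ × ℝ | (hermTwo x).PosDef}.indicator (fun x => cexp (-(hermTwo x * g).trace) * (hermTwo x).det ^ (s - 2)) w := by
  have hs1 : 1 < s.re := by linarith
  have hf := integrable_kernel_lp2 hg hs1
  have hFf := integrable_fourier_kernel hg hs
  have hcont : ContinuousAt (fun y : WithLp 2 (ℝ × WithLp 2 (ℂ × ℝ)) => {x : ℝ × ℂ × ℝ | (hermTwo x).PosDef}.indicator (fun x => cexp (-(hermTwo x * g).trace) * (hermTwo x).det ^ (s - 2)) ((ofLp y).1, ofLp (ofLp y).2)) (toLp 2 (w.1, toLp 2 w.2) : WithLp 2 (ℝ × WithLp 2 (ℂ × ℝ))) := by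
    have h1 : ContinuousAt (fun x : ℝ × ℂ × ℝ => {x : ℝ × ℂ × ℝ | (hermTwo x).PosDef}.indicator (fun x => cexp (-(hermTwo x * g).trace) * (hermTwo x).det ^ (s - 2)) x)
        (((ofLp (toLp 2 (w.1, toLp 2 w.2) : WithLp 2 (ℝ × WithLp 2 (ℂ × ℝ)))).1,
          ofLp (ofLp (toLp 2 (w.1, toLp 2 w.2) : WithLp 2 (ℝ × WithLp 2 (ℂ × ℝ)))).2)) := by
      rw [ofLp2_toLp2]
      exact continuousAt_gammaKernel g (by linarith) w
    exact ContinuousAt.comp (f := fun y : WithLp 2 (ℝ × WithLp 2 (ℂ × ℝ)) => (((ofLp y).1, ofLp (ofLp y).2) : ℝ × ℂ × ℝ))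
      h1 continuous_ofLp2.continuousAt
  have hinv := MeasureTheory.Integrable.fourier_fourierInv_eq hf hFf hcont
  have hval : {x : ℝ × ℂ × ℝ | (hermTwo x).PosDef}.indicator (fun x => cexp (-(hermTwo x * g).trace) * (hermTwo x).det ^ (s - 2))
      (((ofLp (toLp 2 (w.1, toLp 2 w.2) : WithLp 2 (ℝ × WithLp 2 (ℂ × ℝ)))).1,
        ofLp (ofLp (toLp 2 (w.1, toLp 2 w.2) : WithLp 2 (ℝ × WithLp 2 (ℂ × ℝ)))).2)) =
      {x : ℝ × ℂ × ℝ | (hermTwo x).PosDef}.indicator (fun x => cexp (-(hermTwo x * g).trace) * (hermTwo x).det ^ (s - 2)) w := by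
    rw [ofLp2_toLp2]
  -- measurability of the changed-variables integrand
  have hKc : Continuous (fun y : WithLp 2 (ℝ × WithLp 2 (ℂ × ℝ)) =>
      cexp (↑(-2 * Real.pi * ⟪y, (toLp 2 (w.1, toLp 2 w.2) : WithLp 2 (ℝ × WithLp 2 (ℂ × ℝ)))⟫) * I) • 𝓕⁻ (fun y : WithLp 2 (ℝ × WithLp 2 (ℂ × ℝ)) => {x : ℝ × ℂ × ℝ | (hermTwo x).PosDef}.indicator (fun x => cexp (-(hermTwo x * g).trace) * (hermTwo x).det ^ (s - 2)) ((ofLp y).1, ofLp (ofLp y).2)) y) := by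
    refine Continuous.smul (Complex.continuous_exp.comp ?_) (continuous_fourierInv_kernel hg hs1)
    exact (continuous_ofReal.comp (continuous_const.mul (continuous_id.inner continuous_const))).mul continuous_const
  have hιm : Measurable (fun c : ℝ × ℂ × ℝ => (toLp 2 (c.1, toLp 2 c.2) : WithLp 2 (ℝ × WithLp 2 (ℂ × ℝ)))) := measurableEmbedding_toLp2.measurable
  -- the three changes of variables
  have hA := integral_comp_smul_lp2 (fun y : WithLp 2 (ℝ × WithLp 2 (ℂ × ℝ)) =>
      cexp (↑(-2 * Real.pi * ⟪y, (toLp 2 (w.1, toLp 2 w.2) : WithLp 2 (ℝ × WithLp 2 (ℂ × ℝ)))⟫) * I) • 𝓕⁻ (fun y : WithLp 2 (ℝ × WithLp 2 (ℂ × ℝ)) => {x : ℝ × ℂ × ℝ | (hermTwo x).PosDef}.indicator (fun x => cexp (-(hermTwo x * g).trace) * (hermTwo x).det ^ (s - 2)) ((ofLp y).1, ofLp (ofLp y).2)) y) (1 / (2 * Real.pi))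
  have hB := integral_comp_toLp2 (fun y : WithLp 2 (ℝ × WithLp 2 (ℂ × ℝ)) =>
      cexp (↑(-2 * Real.pi * ⟪((1 / (2 * Real.pi) : ℝ)) • y, (toLp 2 (w.1, toLp 2 w.2) : WithLp 2 (ℝ × WithLp 2 (ℂ × ℝ)))⟫) * I) • 𝓕⁻ (fun y : WithLp 2 (ℝ × WithLp 2 (ℂ × ℝ)) => {x : ℝ × ℂ × ℝ | (hermTwo x).PosDef}.indicator (fun x => cexp (-(hermTwo x * g).trace) * (hermTwo x).det ^ (s - 2)) ((ofLp y).1, ofLp (ofLp y).2)) (((1 / (2 * Real.pi) : ℝ)) • y))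
  have hC := integral_comp_dblZ (fun c : ℝ × ℂ × ℝ =>
      cexp (↑(-2 * Real.pi * ⟪((1 / (2 * Real.pi) : ℝ)) • (toLp 2 (c.1, toLp 2 c.2) : WithLp 2 (ℝ × WithLp 2 (ℂ × ℝ))), (toLp 2 (w.1, toLp 2 w.2) : WithLp 2 (ℝ × WithLp 2 (ℂ × ℝ)))⟫) * I) •
        𝓕⁻ (fun y : WithLp 2 (ℝ × WithLp 2 (ℂ × ℝ)) => {x : ℝ × ℂ × ℝ | (hermTwo x).PosDef}.indicator (fun x => cexp (-(hermTwo x * g).trace) * (hermTwo x).det ^ (s - 2)) ((ofLp y).1, ofLp (ofLp y).2)) (((1 / (2 * Real.pi) : ℝ)) • (toLp 2 (c.1, toLp 2 c.2) : WithLp 2 (ℝ × WithLp 2 (ℂ × ℝ)))))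
    ((hKc.measurable.comp (hιm.const_smul (1 / (2 * Real.pi)))).aestronglyMeasurable)
  -- assemble: `∫ (target) = ¼ ∫_V₀ … = ¼ ∫_W …(R • y) = ¼ |R⁴|⁻¹ ∫_W K = ¼ (2π)⁴ 𝓕(𝓕⁻ f̃)(ι w) = 4π⁴ f̃(ι w)`
  have hchain : ∫ c : ℝ × ℂ × ℝ, cexp (-(I * (hermTwo w * hermTwo c).trace)) * (hermTwoGamma s * (g - I • hermTwo c).det ^ (-s)) =
      (4⁻¹ : ℝ) • (|((1 / (2 * Real.pi)) ^ 4)⁻¹| •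
        {x : ℝ × ℂ × ℝ | (hermTwo x).PosDef}.indicator (fun x => cexp (-(hermTwo x * g).trace) * (hermTwo x).det ^ (s - 2)) w) := by
    rw [← hval, ← hinv, Real.fourier_eq', ← hA, ← hB, ← hC]
    exact integral_congr_ae (Filter.Eventually.of_forall fun c => (cov_integrand_eq hg hs1 w c).symm)
  rw [hchain]
  have hπ4 : |((1 / (2 * Real.pi)) ^ 4)⁻¹| = 16 * Real.pi ^ 4 := by
    rw [abs_of_pos (by positivity)]
    field_simp
    ring
  rw [hπ4, smul_smul, Complex.real_smul]
  congr 1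
  push_cast
  ring

/-! ## §3 The inner integral, indicator kept -/

/-- **THE INNER INTEGRAL FOR EVERY `h = hermTwo e` AND EVERY `u`**:
`∫_x e(−τ(hx)) e^{−iτ(ux)} det(g − ix)^{−α} dx = 4π⁴ Γ₂(α)⁻¹ · φ_α(u + 2πh)` with `φ_α = 1_{x>0} e^{−τ(xg)} det(x)^{α−2}` — ★ `inner_integral_eq` off the
hypotheses `h, u > 0` (§2 at `w = u + 2πh`). [cite: Shimura1982, §1 (1.29)] -/
theorem inner_integral_eq_indicator {g : Matrix (Fin 2) (Fin 2) ℂ} (hg : g.PosDef) (e : ℝ × ℂ × ℝ) {α : ℂ} (hα : 3 < α.re) (u : ℝ × ℂ × ℝ) :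
    ∫ c : ℝ × ℂ × ℝ, cexp (-(2 * Real.pi * I) * (hermTwo e * hermTwo c).trace) * cexp (-(I * (hermTwo u * hermTwo c).trace)) *
        (g - I • hermTwo c).det ^ (-α) =
      ((4 * Real.pi ^ 4 : ℝ) : ℂ) * (hermTwoGamma α)⁻¹ *
        {x : ℝ × ℂ × ℝ | (hermTwo x).PosDef}.indicator (fun x => cexp (-(hermTwo x * g).trace) * (hermTwo x).det ^ (α - 2)) (u + (2 * Real.pi) • e) := by
  have hΓ : hermTwoGamma α ≠ 0 := hermTwoGamma_ne_zero (by linarith)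
  have key := integral_cexp_trace_mul_det_cpow_eq_indicator hg hα (u + (2 * Real.pi) • e)
  have h1 : (fun c : ℝ × ℂ × ℝ => cexp (-(2 * Real.pi * I) * (hermTwo e * hermTwo c).trace) *
      cexp (-(I * (hermTwo u * hermTwo c).trace)) * (g - I • hermTwo c).det ^ (-α)) =
      fun c => (hermTwoGamma α)⁻¹ * (cexp (-(I * (hermTwo (u + (2 * Real.pi) • e) * hermTwo c).trace)) *
        (hermTwoGamma α * (g - I • hermTwo c).det ^ (-α))) := by
    funext c
    rw [phase_combine]
    field_simp
  rw [h1, integral_const_mul, key]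
  ring

/-! ## §4 The outer integral: translation onto `etaTwoSet (πh)` for every Hermitian `h` -/

/-- **`∫_u φ_β(u) · φ_α(u + 2πh) du = η(2g, πh; α, β)` FOR EVERY `h = hermTwo e`**: the product of the two kernels lives on `{u > 0} ∩ {u + 2πh > 0}`,
which the translation `x = u + πh` (Lebesgue-measure preserving) carries onto `{x − πh > 0} ∩ {x + πh > 0} = etaTwoSet (πh)` (★ `mem_etaTwoSet_iff`),
and there the integrand is `η`'s: `τ(ug) + τ((u+2πh)g) = τ((u+πh)·2g)` (★ `trace_combine`). [cite: Shimura1982, §3 (3.1)–(3.3)] -/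
theorem integral_kernel_shift_eq_etaTwo_of_isHermitian (g : Matrix (Fin 2) (Fin 2) ℂ) (e : ℝ × ℂ × ℝ) (α β : ℂ) :
    ∫ u : ℝ × ℂ × ℝ, {x : ℝ × ℂ × ℝ | (hermTwo x).PosDef}.indicator (fun x => cexp (-(hermTwo x * g).trace) * (hermTwo x).det ^ (β - 2)) u *
        {x : ℝ × ℂ × ℝ | (hermTwo x).PosDef}.indicator (fun x => cexp (-(hermTwo x * g).trace) * (hermTwo x).det ^ (α - 2)) (u + (2 * Real.pi) • e) =
      etaTwo ((2 : ℂ) • g) ((Real.pi : ℂ) • hermTwo e) α β := by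
  rw [← hermTwo_smul Real.pi e, etaTwo_def]
  -- the translation `x = u + πh` preserves Lebesgue measure
  have hT : MeasurePreserving (fun c : ℝ × ℂ × ℝ => c + Real.pi • e) volume volume := by
    have h := (measurePreserving_add_right (volume : Measure ℝ) (Real.pi • e).1).prod
      ((measurePreserving_add_right (volume : Measure ℂ) (Real.pi • e).2.1).prod
        (measurePreserving_add_right (volume : Measure ℝ) (Real.pi • e).2.2))
    have hf : (fun c : ℝ × ℂ × ℝ => c + Real.pi • e) =
        Prod.map (fun x : ℝ => x + (Real.pi • e).1) (Prod.map (fun x : ℂ => x + (Real.pi • e).2.1) (fun x : ℝ => x + (Real.pi • e).2.2)) := by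
      funext c
      rfl
    rw [hf, Measure.volume_eq_prod, Measure.volume_eq_prod]
    exact h
  have hTe : MeasurableEmbedding (fun c : ℝ × ℂ × ℝ => c + Real.pi • e) := (MeasurableEquiv.addRight (Real.pi • e)).measurableEmbedding
  -- `hermTwo (u + πh) ± hermTwo (πh)`
  have hadd : ∀ u : ℝ × ℂ × ℝ, hermTwo (u + Real.pi • e) + hermTwo (Real.pi • e) = hermTwo (u + (2 * Real.pi) • e) := fun u => by
    rw [← hermTwo_add, two_mul, add_smul, add_assoc]
  have hsub : ∀ u : ℝ × ℂ × ℝ, hermTwo (u + Real.pi • e) - hermTwo (Real.pi • e) = hermTwo u := fun u => by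
    rw [hermTwo_add, add_sub_cancel_right]
  have hpre : (fun c : ℝ × ℂ × ℝ => c + Real.pi • e) ⁻¹' etaTwoSet (hermTwo (Real.pi • e)) =
      {c | (hermTwo (c + (2 * Real.pi) • e)).PosDef ∧ (hermTwo c).PosDef} := by
    ext c
    simp only [Set.mem_preimage, mem_etaTwoSet_iff, Set.mem_setOf_eq, hadd, hsub]
  have hmeas : MeasurableSet {c : ℝ × ℂ × ℝ | (hermTwo (c + (2 * Real.pi) • e)).PosDef ∧ (hermTwo c).PosDef} := by
    rw [Set.setOf_and]
    exact (measurableSet_posDef_hermTwo.preimage (measurable_id.add_const ((2 * Real.pi) • e))).inter measurableSet_posDef_hermTwo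
  rw [← hT.setIntegral_preimage_emb hTe _ (etaTwoSet (hermTwo (Real.pi • e))), hpre, ← integral_indicator hmeas]
  refine integral_congr_ae (Filter.Eventually.of_forall fun u => ?_)
  beta_reduce
  by_cases hu : (hermTwo (u + (2 * Real.pi) • e)).PosDef ∧ (hermTwo u).PosDef
  · rw [gammaKernel_eq_of_posDef g β hu.2, gammaKernel_eq_of_posDef g α hu.1,
      indicator_of_mem (show u ∈ {c : ℝ × ℂ × ℝ | (hermTwo (c + (2 * Real.pi) • e)).PosDef ∧ (hermTwo c).PosDef} from hu), etaTwoIntegrand_apply,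
      hadd, hsub, ← trace_combine g e u, neg_add, Complex.exp_add]
    ring
  · rw [indicator_of_notMem (show u ∉ {c : ℝ × ℂ × ℝ | (hermTwo (c + (2 * Real.pi) • e)).PosDef ∧ (hermTwo c).PosDef} from hu)]
    rcases not_and_or.mp hu with h1 | h2
    · rw [gammaKernel_eq_zero_of_not_posDef g α h1, mul_zero]
    · rw [gammaKernel_eq_zero_of_not_posDef g β h2, zero_mul]

/-! ## §5 HEAD: the ξ–η identity for a Hermitian `h` of any signature -/

/-- **THE ξ–η IDENTITY FOR EVERY HERMITIAN `h`** ([Shimura1982, (1.29)], Case II, `m = κ = 2`; organ «Φ6b-ind» FILE 1): for a positive definite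
Hermitian `2 × 2` matrix `g`, a HERMITIAN `h` of ANY signature, and `re α > 3`, `re β > 1`,
  `ξ(g, h; α, β) = 4π⁴ · e^{iπ(β−α)} · Γ₂(α)⁻¹ · Γ₂(β)⁻¹ · η(2g, πh; α, β)`
— ★ `xiTwo_eq_etaTwo`'s conclusion byte-verbatim with `h.PosDef` weakened to `h.IsHermitian`.  Proof: tube formula for `det(g + ix)^{−β}`
(★ `integral_gammaKernel_mul_cexp_trace`), Fubini (★ `integrable_double`), the inner integral §3 at every `u`, the translation §4.
[cite: Shimura1982, §1 (1.29), §3 (3.1)–(3.3)] [cite: Shimura1997, §16.4] -/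
theorem xiTwo_eq_etaTwo_of_isHermitian {g h : Matrix (Fin 2) (Fin 2) ℂ} (hg : g.PosDef) (hh : h.IsHermitian) {α β : ℂ} (hα : 3 < α.re) (hβ : 1 < β.re) :
    xiTwo g h α β =
      ((4 * Real.pi ^ 4 : ℝ) : ℂ) * cexp ((Real.pi * I) * (β - α)) * (hermTwoGamma α)⁻¹ * (hermTwoGamma β)⁻¹ *
        etaTwo ((2 : ℂ) • g) ((Real.pi : ℂ) • h) α β := by
  -- coordinates of `h`
  obtain ⟨e, rfl⟩ : ∃ e : ℝ × ℂ × ℝ, hermTwo e = h := ⟨_, hermTwo_eq_of_isHermitian hh⟩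
  have hΓα : hermTwoGamma α ≠ 0 := hermTwoGamma_ne_zero (by linarith)
  have hΓβ : hermTwoGamma β ≠ 0 := hermTwoGamma_ne_zero hβ
  -- (1) insert the tube formula for `det(g + ix)^{−β}` and (2) Fubini
  have hG := integrable_double hg e hα hβ
  have step1 : xiTwo g (hermTwo e) α β = cexp ((Real.pi * I) * (β - α)) * (hermTwoGamma β)⁻¹ *
      ∫ c : ℝ × ℂ × ℝ, ∫ u : ℝ × ℂ × ℝ,
        cexp (-(2 * Real.pi * I) * (hermTwo e * hermTwo c).trace) * (g - I • hermTwo c).det ^ (-α) *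
          ({x : ℝ × ℂ × ℝ | (hermTwo x).PosDef}.indicator (fun x => cexp (-(hermTwo x * g).trace) * (hermTwo x).det ^ (β - 2)) u *
            cexp (-(I * (hermTwo u * hermTwo c).trace))) := by
    rw [xiTwo_def, ← integral_const_mul]
    refine integral_congr_ae (Filter.Eventually.of_forall fun c => ?_)
    beta_reduce
    rw [xiTwoIntegrand_eq, integral_const_mul, integral_gammaKernel_mul_cexp_trace hg hβ c]
    field_simp
  rw [step1, integral_integral_swap hG]
  -- (3) the inner integral, pointwise in `u` (no case split: §3 holds at every `u`)
  have step3 : (fun u : ℝ × ℂ × ℝ => ∫ c : ℝ × ℂ × ℝ,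
        cexp (-(2 * Real.pi * I) * (hermTwo e * hermTwo c).trace) * (g - I • hermTwo c).det ^ (-α) *
          ({x : ℝ × ℂ × ℝ | (hermTwo x).PosDef}.indicator (fun x => cexp (-(hermTwo x * g).trace) * (hermTwo x).det ^ (β - 2)) u *
            cexp (-(I * (hermTwo u * hermTwo c).trace)))) =
      fun u => ((4 * Real.pi ^ 4 : ℝ) : ℂ) * (hermTwoGamma α)⁻¹ *
        ({x : ℝ × ℂ × ℝ | (hermTwo x).PosDef}.indicator (fun x => cexp (-(hermTwo x * g).trace) * (hermTwo x).det ^ (β - 2)) u *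
          {x : ℝ × ℂ × ℝ | (hermTwo x).PosDef}.indicator (fun x => cexp (-(hermTwo x * g).trace) * (hermTwo x).det ^ (α - 2)) (u + (2 * Real.pi) • e)) := by
    funext u
    have h1 : (fun c : ℝ × ℂ × ℝ =>
        cexp (-(2 * Real.pi * I) * (hermTwo e * hermTwo c).trace) * (g - I • hermTwo c).det ^ (-α) *
          ({x : ℝ × ℂ × ℝ | (hermTwo x).PosDef}.indicator (fun x => cexp (-(hermTwo x * g).trace) * (hermTwo x).det ^ (β - 2)) u *
            cexp (-(I * (hermTwo u * hermTwo c).trace)))) =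
        fun c => {x : ℝ × ℂ × ℝ | (hermTwo x).PosDef}.indicator
            (fun x => cexp (-(hermTwo x * g).trace) * (hermTwo x).det ^ (β - 2)) u *
          (cexp (-(2 * Real.pi * I) * (hermTwo e * hermTwo c).trace) * cexp (-(I * (hermTwo u * hermTwo c).trace)) *
            (g - I • hermTwo c).det ^ (-α)) := by
      funext c
      ring
    rw [h1, integral_const_mul, inner_integral_eq_indicator hg e hα u]
    ring
  rw [step3, integral_const_mul, integral_kernel_shift_eq_etaTwo_of_isHermitian g e α β]
  ring

end Summit.HodgeConjecture.HodgeConjecture.Cruxes.HLiu418.K2LiuHermTwoXiEtaIdentityIndefinite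

end
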